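/-
Copyright (c) 2026 the pub-hodgecm-mathlib formalisation cell (harness21).  Prover seat hodgecm-mathlib-K2E1-p02 (g0), Track B ∕ K2-LIT
(build stream 29), h413 = `stmt-HodgeConjecture-24833`, line `K2_E1_TraceFormulaBeta`, TABLE row 10 (HELD ★ DEFS leaf) — dealer K2E1-plan (g0) POOL-E
DEAL 2026-09-03T21:55:31Z (spec K2/STATUS l.695).  2026-09-03.
-/
import Literature.NumberTheory.Automorphic.UnitaryGroupAdelicProduct        -- ★ `archPart`, `finPart`, `adelicProdEquiv`, `arch`, `finAdelic`, `evalPlace`, `finAdelicEquiv`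
import Literature.NumberTheory.Automorphic.LocalUnitaryIntegralLevel          -- ★ `cmLocalIntegralLevel` (compact open), `localPiEquiv_mem_localIntegralLevel_iff`
import Literature.NumberTheory.Rogawski1990.LocalTransferFundamentalLemma     -- ★ `IsLocSmooth` (= locally constant + compact support, [Rogawski1990, §1.6])
import Mathlib.Topology.ContinuousMap.CompactlySupported
import HarnessLib

/-!
# h413 ∕ Track B «K2-LIT», line `K2_E1_TraceFormulaBeta`, row 10 — ★ DEFS leaf `K2E1GlobalTestFunctionsDefs`:
# GLOBAL TEST FUNCTIONS `φ = φ_∞ ⊗ ⊗'_u φ_u` on `U(H)(𝔸_{L⁺})` and their realisation `toAdelic φ ∈ C_c(U(H)(𝔸_{L⁺}), ℂ)`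

Cell `pub/hodgecm-mathlib`, crux H413 = `stmt-HodgeConjecture-24833`, route of record `HCCMUnconditional`; chair K2-lead (g0), dealer K2E1-plan (g0), POOL-E
DEAL of 21:55:31Z to seat K2E1-p02 (g0) (spec = K2/STATUS l.695, originally named for K2E1-p05): the HELD row 10 of the K2_E1 TABLE, the blocker of rows
12-tc(smooth) ∕ 13 ∕ 15–18.  DEFINITIONS + proved structural theorems; no `instance`, no `notation`, no named-fact hypothesis, no `sorry`; lane
`--kind definition --supports stmt-HodgeConjecture-24833 --as helper` (review-queued DEFS leaf, count-neutral).

THE OBJECTS (tree currency throughout; `L` a CM field, `L⁺ = maximalRealSubfield L`, `c̄ = IsCMField.complexConj L`, `H ∈ M_N(L)`, the datum ★ `UnitaryGroup.cmDatum L N H`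
whose adelic group `U(H)(𝔸_{L⁺})` is ★ `adelic L⁺ L c̄ N H ≤ GL_N(𝔸_L)`).
* `GlobalTestFunction L N H` — a PURE TENSOR of local test functions [Rogawski1990, §1.6 p. 6 («`C(G, ω)`»), §14.2 p. 233; BorelJacquet1979, §4.1]:
  - an ARCHIMEDEAN component `arch : U(H)(L ⊗ ℝ) → ℂ` on ★ `UnitaryGroup.arch L⁺ L c̄ N H ≤ GL_N(L ⊗ ℝ)`, continuous, compactly supported and SMOOTH IN THE ARCHIMEDEAN VARIABLE in
    exactly the currency of the letter ★ `UnitaryGroup.ArchIntegratedOperatorTraceClass` ∕ clause (i) of ★ `Rogawski1990.ArchTestKc` (a restriction of a continuous compactly supported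
    `φ' : GL_N(L ⊗ ℝ) → ℂ` with ★ `IsArchSmooth (archGroupGL N L).carrier.subtype φ'`);
  - FINITE components `fin u : (cmDatum L N H).Local u → ℂ`, each ★ `IsLocSmooth` (locally constant, compactly supported = `C_c^∞` of a totally disconnected group), and
    `fin u = 𝟙_{K_u}` (indicator of the integral level ★ `cmLocalIntegralLevel L N H u = U(H)(𝒪_u)`) for ALL BUT FINITELY MANY `u` (`Filter.cofinite`).
* `locComp u : U(H)(𝔸_{L⁺}) →* (cmDatum L N H).Local u` — the `u`-COMPONENT in the datum's currency: finite part (★ `finPart`), `u`-coordinate of the restricted product (★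
  `evalPlace`), moved to the matrix carrier along ★ `localPiEquiv` (so `locComp u g = toLocal u (1, g_f)`, ★ `localPiEquiv_evalPlace`); continuous, and `locComp u g ∈ K_u` for
  almost all `u` (★ `eventually_evalPlace_mem_localInt`).
* `finFactor φ g = ∏ᶠ u, fin u (locComp u g)` (a `finprod`, genuinely finite: `mulSupport_fin_locComp_finite`) and
  **`toAdelic φ : C_c(U(H)(𝔸_{L⁺}), ℂ)`**, `toAdelic φ g = arch (archPart g) · ∏_u fin u (locComp u g)` — CONTINUITY (`continuous_toFun`: near `g₀` the product is a finite product over a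
  fixed finite set of places, the remaining factors being `𝟙_{K_u}(k_u) = 1` on the OPEN box `{g | ∀ u ∉ S, g_u ∈ K_u}`, Mathlib `RestrictedProduct.isOpen_forall_imp_mem`) and
  COMPACT SUPPORT (`hasCompactSupport_toFun`: the support lies in `archPart⁻¹(tsupport φ_∞) ∩ ⋂_u locComp_u⁻¹(tsupport φ_u)`, a product of compacta which is compact in the
  restricted product — `isCompact_restrictedProduct_box`, the box lemma «`Π_u C_u` with `C_u = K_u` a.e. is compact in `∏' (G_u : K_u)`», proved here after Mathlib's
  `RestrictedProduct.weaklyLocallyCompactSpace_of_principal`) are PROVED, so `toAdelic` is an honest member of `C_c` (Mathlib `CompactlySupportedContinuousMap`).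
NOT HERE (row 18, not asked): the factorisation of `R(toAdelic φ)` on restricted-tensor-product vectors; the identification `locComp u g = (cmDatum L N H).toLocal u g`
(needs «`toLocal u ∘ archToAdelic = 1`», absent from ★ — TO BUILD, one lemma over ★ `UnitaryGroupArchimedean`); density of `{toAdelic φ}` in `C_c` for `‖·‖_{L¹}`.

HONEST LABEL.  Definitions leaf; proves no printed letter; HC_CM is proved only modulo the 7 printed citations (2 remaining named inputs: hLiu418 = `stmt-HodgeConjecture-24832`,
h413 = `stmt-HodgeConjecture-24833`) until rung 0 closes.
References: [Rogawski1990] §1.6 p. 6, §14.2 p. 233; [BorelJacquet1979] §1.1, §4.1 («`f = f_∞ ⊗ f^∞`, `f^∞ = Π f_v`, `f_v = 𝟙_{K_v}` a.e.»); [PlatonovRapinchuk1994] §5.1 (restricted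
products); [GetzHahn2024] §3.1–3.2 (adelic points, restricted products), Def. 9.1 context.
-/

set_option autoImplicit false
-- the mandated namespace repeats `HodgeConjecture.HodgeConjecture`, as in every `Theorems/*.lean` of this sub-problem
set_option linter.dupNamespace false

noncomputable section

open NumberField IsDedekindDomain Filter Topology Set
-- `Classical`: the place subtypes indexing `mixedSpace L` are `Fintype` classically (`NormedCommRing (mixedSpace L)`), as in ★ `UnitaryGroupArchCharacterTraceClass`.
open scoped RestrictedProduct Classical

namespace Summit.HodgeConjecture.HodgeConjecture.Cruxes.H413.K2E1GlobalTestFunctions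

open Literature.NumberTheory.Automorphic Literature.NumberTheory.Automorphic.UnitaryGroup
open Literature.NumberTheory.Rogawski1990 (IsLocSmooth)

/-! ## §0 The box lemma for restricted products: `Π_i C_i` with `C_i` compact, `C_i ⊆ A_i` a.e., is compact -/

section Box

variable {ι : Type*} {R : ι → Type*} [∀ i, TopologicalSpace (R i)] {A : ∀ i, Set (R i)}

/-- **Boxes with compact sides, almost all inside the structure sets, are COMPACT in the restricted product** `Πʳ i, [R i, A i]` (cofinite filter): if every `C i`
is compact and `C i ⊆ A i` for all but finitely many `i`, then `{x | ∀ i, x i ∈ C i}` is compact.  (It is the image under the continuous inclusion of the principal piece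
`Πʳ i, [R i, A i]_[𝓟 S]`, `S = {i | C i ⊆ A i}`, of the preimage of the compact product `Π_i C_i` under the embedding into `Π_i R_i` — the argument of Mathlib's
`RestrictedProduct.weaklyLocallyCompactSpace_of_principal`.) [cite: PlatonovRapinchuk1994, §5.1] -/
theorem isCompact_restrictedProduct_box (C : ∀ i, Set (R i)) (hC : ∀ i, IsCompact (C i)) (hCA : ∀ᶠ i in cofinite, C i ⊆ A i) :
    IsCompact {x : Πʳ i, [R i, A i] | ∀ i, x i ∈ C i} := by
  set S : Set ι := {i | C i ⊆ A i} with hSdef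
  have hS : (cofinite : Filter ι) ≤ 𝓟 S := le_principal_iff.2 hCA
  -- the box inside the principal piece, as the preimage of the compact product box
  set Q : Set (Π i, R i) := univ.pi C with hQ
  have hQc : IsCompact Q := isCompact_univ_pi hC
  have hQrange : Q ⊆ range ((↑) : Πʳ i, [R i, A i]_[𝓟 S] → Π i, R i) := by
    rw [RestrictedProduct.range_coe_principal]
    intro x hx i hi
    exact hi (hx i (mem_univ i))
  have hQ' : IsCompact (((↑) : Πʳ i, [R i, A i]_[𝓟 S] → Π i, R i) ⁻¹' Q) :=
    (RestrictedProduct.isEmbedding_coe_of_principal.isCompact_preimage_iff hQrange).2 hQc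
  -- its image under the (continuous) inclusion is the box
  have himage : RestrictedProduct.inclusion R A hS '' (((↑) : Πʳ i, [R i, A i]_[𝓟 S] → Π i, R i) ⁻¹' Q) =
      {x : Πʳ i, [R i, A i] | ∀ i, x i ∈ C i} := by
    ext x
    constructor
    · rintro ⟨y, hy, rfl⟩ i
      exact hy i (mem_univ i)
    · intro hx
      have hxS : ∀ᶠ i in 𝓟 S, x i ∈ A i := eventually_principal.2 fun i hi => hi (hx i)
      obtain ⟨y, rfl⟩ := RestrictedProduct.exists_inclusion_eq_of_eventually R A hS hxS
      exact ⟨y, fun i _ => hx i, rfl⟩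
  rw [← himage]
  exact hQ'.image (RestrictedProduct.continuous_inclusion hS)

end Box

/-! ## §1 The structure -/

variable (L : Type) [Field L] [NumberField L] [IsCMField L] (N : ℕ) (H : Matrix (Fin N) (Fin N) L)

/-- **A GLOBAL TEST FUNCTION on `U(H)(𝔸_{L⁺})`, as a pure tensor `φ_∞ ⊗ ⊗'_u φ_u`** [Rogawski1990, §1.6, §14.2; BorelJacquet1979, §4.1]: an archimedean component
`arch : U(H)(L ⊗ ℝ) → ℂ` (★ `UnitaryGroup.arch`), continuous, compactly supported and smooth in the archimedean variable in the currency of ★ `ArchIntegratedOperatorTraceClass` ∕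
★ `ArchTestKc` (i) (the restriction of a continuous compactly supported `φ' : GL_N(L ⊗ ℝ) → ℂ` with ★ `IsArchSmooth (archGroupGL N L).carrier.subtype φ'`); finite components
`fin u : (cmDatum L N H).Local u → ℂ`, each ★ `IsLocSmooth` (locally constant with compact support), equal to the indicator `𝟙_{K_u}` of the integral level ★ `cmLocalIntegralLevel L N H u`
for all but finitely many finite places `u` of `L⁺`. [cite: Rogawski1990, §1.6 p. 6; §14.2 p. 233] [cite: BorelJacquet1979, §4.1] -/
structure GlobalTestFunction where
  /-- The archimedean component `φ_∞ : U(H)(L ⊗ ℝ) → ℂ`. -/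
  arch : UnitaryGroup.arch (↥(maximalRealSubfield L)) L (IsCMField.complexConj L) N H → ℂ
  /-- `φ_∞` is continuous. -/
  continuous_arch : Continuous arch
  /-- `φ_∞` is compactly supported. -/
  hasCompactSupport_arch : HasCompactSupport arch
  /-- `φ_∞` is smooth in the archimedean variable (clause (i) of ★ `ArchTestKc`, rank `N`). -/
  isArchSmooth_arch : ∃ φ' : GL (Fin N) (NumberField.mixedEmbedding.mixedSpace L) → ℂ, Continuous φ' ∧ HasCompactSupport φ' ∧
    IsArchSmooth (archGroupGL N L).carrier.subtype φ' ∧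
    ∀ k : UnitaryGroup.arch (↥(maximalRealSubfield L)) L (IsCMField.complexConj L) N H, arch k = φ' (k : GL (Fin N) (NumberField.mixedEmbedding.mixedSpace L))
  /-- The finite components `φ_u : U(H)(L⁺_u) → ℂ`. -/
  fin : ∀ u : HeightOneSpectrum (𝓞 ↥(maximalRealSubfield L)), (UnitaryGroup.cmDatum L N H).Local u → ℂ
  /-- Each `φ_u` is locally constant with compact support. -/
  isLocSmooth_fin : ∀ u, IsLocSmooth (fin u)
  /-- `φ_u = 𝟙_{U(H)(𝒪_u)}` for almost all `u`. -/
  fin_eventually_eq_indicator : ∀ᶠ u in cofinite, fin u = (cmLocalIntegralLevel L N H u : Set ((UnitaryGroup.cmDatum L N H).Local u)).indicator 1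

/-! ## §2 The local components of an adelic point, in the datum's currency -/

/-- **`locComp u : U(H)(𝔸_{L⁺}) →* U(H)(L⁺_u) = (cmDatum L N H).Local u`** — the `u`-component: the finite part (★ `finPart`), its `u`-coordinate in the restricted product (★
`evalPlace`), transported to the matrix carrier along ★ `localPiEquiv` (so that `locComp u g = toLocal u (1, g_f)`, ★ `localPiEquiv_evalPlace`). [cite: PlatonovRapinchuk1994, §5.1]
[cite: BorelJacquet1979, §4.1] -/
def locComp (u : HeightOneSpectrum (𝓞 ↥(maximalRealSubfield L))) :
    (UnitaryGroup.cmDatum L N H).Adelic →* (UnitaryGroup.cmDatum L N H).Local u :=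
  ((localPiEquiv L (IsCMField.complexConj L) N H u).toMulEquiv.toMonoidHom.comp
      (evalPlace (↥(maximalRealSubfield L)) L (IsCMField.complexConj L) N H u)).comp
    (finPart (↥(maximalRealSubfield L)) L (IsCMField.complexConj L) N H)

/-- Unfolding of `locComp`. [folklore] -/
theorem locComp_apply (u : HeightOneSpectrum (𝓞 ↥(maximalRealSubfield L))) (g : (UnitaryGroup.cmDatum L N H).Adelic) :
    locComp L N H u g = localPiEquiv L (IsCMField.complexConj L) N H u
      (evalPlace (↥(maximalRealSubfield L)) L (IsCMField.complexConj L) N H u (finPart (↥(maximalRealSubfield L)) L (IsCMField.complexConj L) N H g)) := rfl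

/-- `locComp u` is continuous. [folklore] -/
theorem continuous_locComp (u : HeightOneSpectrum (𝓞 ↥(maximalRealSubfield L))) : Continuous (locComp L N H u) :=
  ((localPiEquiv L (IsCMField.complexConj L) N H u).continuous.comp (continuous_evalPlace _ _ _ _ _ u)).comp (continuous_finPart _ _ _ _ _)

/-- `locComp u g ∈ U(H)(𝒪_u)` iff the `u`-coordinate of the finite part lies in ★ `localInt` (★ `localPiEquiv_mem_localIntegralLevel_iff`). [cite: PlatonovRapinchuk1994, §5.1] -/
theorem locComp_mem_iff (u : HeightOneSpectrum (𝓞 ↥(maximalRealSubfield L))) (g : (UnitaryGroup.cmDatum L N H).Adelic) :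
    locComp L N H u g ∈ cmLocalIntegralLevel L N H u ↔
      finAdelicEquiv (↥(maximalRealSubfield L)) L (IsCMField.complexConj L) N H (finPart (↥(maximalRealSubfield L)) L (IsCMField.complexConj L) N H g) u ∈
        localInt L (IsCMField.complexConj L) N H u :=
  localPiEquiv_mem_localIntegralLevel_iff (IsCMField.complexConj L) N H u _

/-- **Almost all components are integral**: `locComp u g ∈ U(H)(𝒪_u)` for all but finitely many `u` (★ `eventually_evalPlace_mem_localInt`). [cite: BorelJacquet1979, §4.1] -/
theorem eventually_locComp_mem (g : (UnitaryGroup.cmDatum L N H).Adelic) : ∀ᶠ u in cofinite, locComp L N H u g ∈ cmLocalIntegralLevel L N H u := by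
  filter_upwards [eventually_evalPlace_mem_localInt (↥(maximalRealSubfield L)) L (IsCMField.complexConj L) N H
    (finPart (↥(maximalRealSubfield L)) L (IsCMField.complexConj L) N H g)] with u hu
  exact (locComp_mem_iff L N H u g).2 hu

/-- **The box of adelic points with prescribed integral components is OPEN**: for a finite exceptional set (given as a cofinite-eventually-true predicate `p`), `{g | ∀ u, p u →
locComp u g ∈ U(H)(𝒪_u)}` is open (Mathlib `RestrictedProduct.isOpen_forall_imp_mem` through ★ `finAdelicEquiv`, ★ `isOpen_localInt`). [cite: PlatonovRapinchuk1994, §5.1] -/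
theorem isOpen_setOf_forall_imp_locComp_mem (p : HeightOneSpectrum (𝓞 ↥(maximalRealSubfield L)) → Prop) :
    IsOpen {g : (UnitaryGroup.cmDatum L N H).Adelic | ∀ u, p u → locComp L N H u g ∈ cmLocalIntegralLevel L N H u} := by
  have hbox := RestrictedProduct.isOpen_forall_imp_mem (R := fun v => ↥(localPi L (IsCMField.complexConj L) N H v))
    (A := fun v => (localInt L (IsCMField.complexConj L) N H v : Set (localPi L (IsCMField.complexConj L) N H v)))
    (fun v => isOpen_localInt L (IsCMField.complexConj L) N H v) (p := p)
  have hcont : Continuous fun g : (UnitaryGroup.cmDatum L N H).Adelic =>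
      finAdelicEquiv (↥(maximalRealSubfield L)) L (IsCMField.complexConj L) N H (finPart (↥(maximalRealSubfield L)) L (IsCMField.complexConj L) N H g) :=
    (finAdelicEquiv _ _ _ _ _).continuous.comp (continuous_finPart _ _ _ _ _)
  convert hbox.preimage hcont using 1
  ext g
  simp only [mem_setOf_eq, mem_preimage, locComp_mem_iff]
  rfl

/-! ## §3 The realisation `toAdelic φ : C_c(U(H)(𝔸_{L⁺}), ℂ)` -/

variable {L N H}

/-- The finite-part factor `∏_u φ_u(g_u)` as a `finprod` (finite: `mulSupport_fin_locComp_finite`). [cite: BorelJacquet1979, §4.1] -/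
def finFactor (φ : GlobalTestFunction L N H) (g : (UnitaryGroup.cmDatum L N H).Adelic) : ℂ :=
  ∏ᶠ u, φ.fin u (locComp L N H u g)

/-- The underlying function `g ↦ φ_∞(g_∞) · ∏_u φ_u(g_u)` of `toAdelic φ`. [cite: BorelJacquet1979, §4.1] [cite: Rogawski1990, §14.2 p. 233] -/
def toFun (φ : GlobalTestFunction L N H) (g : (UnitaryGroup.cmDatum L N H).Adelic) : ℂ :=
  φ.arch (archPart (↥(maximalRealSubfield L)) L (IsCMField.complexConj L) N H g) * finFactor φ g

/-- The finite set of places where `φ_u ≠ 𝟙_{K_u}` or `g_u ∉ K_u` carries every non-trivial factor: outside it `φ_u(g_u) = 𝟙_{K_u}(g_u) = 1`. [cite: BorelJacquet1979, §4.1] -/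
theorem fin_locComp_eq_one (φ : GlobalTestFunction L N H) {u : HeightOneSpectrum (𝓞 ↥(maximalRealSubfield L))} {g : (UnitaryGroup.cmDatum L N H).Adelic}
    (hφ : φ.fin u = (cmLocalIntegralLevel L N H u : Set ((UnitaryGroup.cmDatum L N H).Local u)).indicator 1)
    (hg : locComp L N H u g ∈ cmLocalIntegralLevel L N H u) : φ.fin u (locComp L N H u g) = 1 := by
  rw [hφ, Set.indicator_of_mem hg, Pi.one_apply]

/-- **The product `∏_u φ_u(g_u)` is finite**: the multiplicative support of `u ↦ φ_u(g_u)` is finite for every adelic `g`. [cite: BorelJacquet1979, §4.1] -/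
theorem mulSupport_fin_locComp_finite (φ : GlobalTestFunction L N H) (g : (UnitaryGroup.cmDatum L N H).Adelic) :
    (Function.mulSupport fun u => φ.fin u (locComp L N H u g)).Finite := by
  refine ((φ.fin_eventually_eq_indicator.and (eventually_locComp_mem L N H g)).mono ?_)
  rintro u ⟨hφ, hg⟩
  exact fin_locComp_eq_one φ hφ hg

/-- On the open box `{g | ∀ u ∉ S, g_u ∈ K_u}`, for `S ⊇ {u | φ_u ≠ 𝟙_{K_u}}` finite, the product is the FINITE product over `S`. [cite: BorelJacquet1979, §4.1] -/
theorem finFactor_eq_prod (φ : GlobalTestFunction L N H) (S : Finset (HeightOneSpectrum (𝓞 ↥(maximalRealSubfield L))))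
    (hS : ∀ u, u ∉ S → φ.fin u = (cmLocalIntegralLevel L N H u : Set ((UnitaryGroup.cmDatum L N H).Local u)).indicator 1)
    {g : (UnitaryGroup.cmDatum L N H).Adelic} (hg : ∀ u, u ∉ S → locComp L N H u g ∈ cmLocalIntegralLevel L N H u) :
    finFactor φ g = ∏ u ∈ S, φ.fin u (locComp L N H u g) := by
  refine finprod_eq_prod_of_mulSupport_subset _ fun u hu => ?_
  by_contra hS'
  exact hu (fin_locComp_eq_one φ (hS u (Finset.mem_coe.not.1 hS')) (hg u (Finset.mem_coe.not.1 hS')))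

/-- **`g ↦ ∏_u φ_u(g_u)` is CONTINUOUS on `U(H)(𝔸_{L⁺})`**: near `g₀` it is a finite product over the fixed finite set `S = {φ_u ≠ 𝟙_{K_u}} ∪ {g₀,u ∉ K_u}` of continuous factors
(`φ_u` locally constant, `locComp u` continuous), the other factors being `1` on the open box `{g | ∀ u ∉ S, g_u ∈ K_u}` (`isOpen_setOf_forall_imp_locComp_mem`). [cite: BorelJacquet1979, §4.1] -/
theorem continuous_finFactor (φ : GlobalTestFunction L N H) : Continuous (finFactor φ) := by
  classical
  refine continuous_iff_continuousAt.2 fun g₀ => ?_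
  obtain ⟨S, hS⟩ : ∃ S : Finset (HeightOneSpectrum (𝓞 ↥(maximalRealSubfield L))), ∀ u, u ∉ S →
      φ.fin u = (cmLocalIntegralLevel L N H u : Set ((UnitaryGroup.cmDatum L N H).Local u)).indicator 1 ∧ locComp L N H u g₀ ∈ cmLocalIntegralLevel L N H u := by
    have h := φ.fin_eventually_eq_indicator.and (eventually_locComp_mem L N H g₀)
    rw [Filter.eventually_cofinite] at h
    exact ⟨h.toFinset, fun u hu => not_not.1 fun h' => hu (h.mem_toFinset.2 h')⟩
  set V := {g : (UnitaryGroup.cmDatum L N H).Adelic | ∀ u, u ∉ S → locComp L N H u g ∈ cmLocalIntegralLevel L N H u} with hV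
  have hVo : IsOpen V := isOpen_setOf_forall_imp_locComp_mem L N H fun u => u ∉ S
  have hg₀ : g₀ ∈ V := fun u hu => (hS u hu).2
  have hcont : Continuous fun g : (UnitaryGroup.cmDatum L N H).Adelic => ∏ u ∈ S, φ.fin u (locComp L N H u g) :=
    continuous_finsetProd _ fun u _ => (φ.isLocSmooth_fin u).1.continuous.comp (continuous_locComp L N H u)
  refine (hcont.continuousAt (x := g₀)).congr ?_
  filter_upwards [hVo.mem_nhds hg₀] with g hg
  exact (finFactor_eq_prod φ S (fun u hu => (hS u hu).1) hg).symm

/-- **`toFun φ` is continuous.** [cite: BorelJacquet1979, §4.1] -/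
theorem continuous_toFun (φ : GlobalTestFunction L N H) : Continuous (toFun φ) :=
  (φ.continuous_arch.comp (continuous_archPart _ _ _ _ _)).mul (continuous_finFactor φ)

/-- A vanishing factor kills the (finite) product. [folklore] -/
theorem finFactor_eq_zero (φ : GlobalTestFunction L N H) {g : (UnitaryGroup.cmDatum L N H).Adelic} (u : HeightOneSpectrum (𝓞 ↥(maximalRealSubfield L)))
    (hu : φ.fin u (locComp L N H u g) = 0) : finFactor φ g = 0 :=
  finprod_eq_zero (fun u => φ.fin u (locComp L N H u g)) u hu (mulSupport_fin_locComp_finite φ g)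

/-- **`toFun φ` HAS COMPACT SUPPORT**: it vanishes off `archPart⁻¹(tsupport φ_∞) ∩ ⋂_u locComp_u⁻¹(tsupport φ_u)`, which corresponds under ★ `adelicProdEquiv` and ★ `finAdelicEquiv` to the
product of the compact `tsupport φ_∞` with a box of compact sides `tsupport φ_u`, contained in the compact open `K_u` for almost all `u` — compact by `isCompact_restrictedProduct_box`.
[cite: BorelJacquet1979, §4.1] [cite: PlatonovRapinchuk1994, §5.1] -/
theorem hasCompactSupport_toFun (φ : GlobalTestFunction L N H) : HasCompactSupport (toFun φ) := by
  classical
  -- the sides of the box, on the restricted-product carrier `localPi`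
  set C : ∀ u : HeightOneSpectrum (𝓞 ↥(maximalRealSubfield L)), Set (localPi L (IsCMField.complexConj L) N H u) :=
    fun u => localPiEquiv L (IsCMField.complexConj L) N H u ⁻¹' tsupport (φ.fin u) with hCdef
  have hCc : ∀ u, IsCompact (C u) := fun u =>
    (localPiEquiv L (IsCMField.complexConj L) N H u).toHomeomorph.isCompact_preimage.2 (φ.isLocSmooth_fin u).2
  have hCA : ∀ᶠ u in cofinite, C u ⊆ (localInt L (IsCMField.complexConj L) N H u : Set (localPi L (IsCMField.complexConj L) N H u)) := by
    filter_upwards [φ.fin_eventually_eq_indicator] with u hu x hx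
    have hK : IsClosed (cmLocalIntegralLevel L N H u : Set ((UnitaryGroup.cmDatum L N H).Local u)) :=
      Subgroup.isClosed_of_isOpen _ (isCompact_isOpen_cmLocalIntegralLevel L N H u).2
    have hx' : localPiEquiv L (IsCMField.complexConj L) N H u x ∈ tsupport (φ.fin u) := hx
    rw [hu] at hx'
    have hmem : localPiEquiv L (IsCMField.complexConj L) N H u x ∈ (cmLocalIntegralLevel L N H u : Set ((UnitaryGroup.cmDatum L N H).Local u)) :=
      hK.closure_subset_iff.2 (Set.support_indicator_subset) hx'
    exact (localPiEquiv_mem_localIntegralLevel_iff (IsCMField.complexConj L) N H u x).1 hmem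
  -- the compact box, transported to `U(H)(𝔸_{L⁺}) ≃ U(H)(L ⊗ ℝ) × U(H)(𝔸_{L⁺,f})`
  have hB := isCompact_restrictedProduct_box C hCc hCA
  set Kf : Set ↥(finAdelic (↥(maximalRealSubfield L)) L (IsCMField.complexConj L) N H) :=
    finAdelicEquiv (↥(maximalRealSubfield L)) L (IsCMField.complexConj L) N H ⁻¹'
      {x : Πʳ u : HeightOneSpectrum (𝓞 ↥(maximalRealSubfield L)), [localPi L (IsCMField.complexConj L) N H u, localInt L (IsCMField.complexConj L) N H u] |
        ∀ u, x u ∈ C u} with hKf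
  have hKfc : IsCompact Kf := (finAdelicEquiv (↥(maximalRealSubfield L)) L (IsCMField.complexConj L) N H).toHomeomorph.isCompact_preimage.2 hB
  set K : Set (UnitaryGroup.cmDatum L N H).Adelic :=
    adelicProdEquiv (↥(maximalRealSubfield L)) L (IsCMField.complexConj L) N H ⁻¹' (tsupport φ.arch ×ˢ Kf) with hKdef
  have hKc : IsCompact K :=
    (adelicProdEquiv (↥(maximalRealSubfield L)) L (IsCMField.complexConj L) N H).toHomeomorph.isCompact_preimage.2 (φ.hasCompactSupport_arch.prod hKfc)
  refine HasCompactSupport.intro hKc fun g hg => ?_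
  have hg' : ¬ (archPart (↥(maximalRealSubfield L)) L (IsCMField.complexConj L) N H g ∈ tsupport φ.arch ∧
      finPart (↥(maximalRealSubfield L)) L (IsCMField.complexConj L) N H g ∈ Kf) := by
    simpa only [hKdef, mem_preimage, adelicProdEquiv_apply, mem_prod] using hg
  rcases not_and_or.1 hg' with h1 | h2
  · exact mul_eq_zero_of_left (image_eq_zero_of_notMem_tsupport h1) _
  · have h2' : ∃ u, finAdelicEquiv (↥(maximalRealSubfield L)) L (IsCMField.complexConj L) N H
        (finPart (↥(maximalRealSubfield L)) L (IsCMField.complexConj L) N H g) u ∉ C u := by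
      simpa only [hKf, mem_preimage, mem_setOf_eq, not_forall] using h2
    obtain ⟨u, hu⟩ := h2'
    exact mul_eq_zero_of_right _ (finFactor_eq_zero φ u (image_eq_zero_of_notMem_tsupport hu))

/-- **`toAdelic φ ∈ C_c(U(H)(𝔸_{L⁺}), ℂ)` — THE GLOBAL TEST FUNCTION AS A CONTINUOUS COMPACTLY SUPPORTED FUNCTION on the adelic group** (Mathlib `CompactlySupportedContinuousMap`):
`g ↦ φ_∞(g_∞) · ∏_u φ_u(g_u)` with `continuous_toFun`, `hasCompactSupport_toFun`.  This is the `f = f_∞ ⊗ f^∞`, `f^∞ = Π_v f_v` of the trace formula's test functions, typed so that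
★ `integratedOperator` ∕ `R(f)` (rows 12–18) applies to it. [cite: BorelJacquet1979, §4.1] [cite: Rogawski1990, §14.2 p. 233] -/
def toAdelic (φ : GlobalTestFunction L N H) : CompactlySupportedContinuousMap (UnitaryGroup.cmDatum L N H).Adelic ℂ :=
  ⟨⟨toFun φ, continuous_toFun φ⟩, hasCompactSupport_toFun φ⟩

/-- Unfolding: `toAdelic φ g = φ_∞(archPart g) · ∏ᶠ u, φ_u(locComp u g)`. [cite: BorelJacquet1979, §4.1] -/
theorem toAdelic_apply (φ : GlobalTestFunction L N H) (g : (UnitaryGroup.cmDatum L N H).Adelic) :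
    toAdelic φ g = φ.arch (archPart (↥(maximalRealSubfield L)) L (IsCMField.complexConj L) N H g) * ∏ᶠ u, φ.fin u (locComp L N H u g) := rfl

/-- **Factorised value on an integral box**: if `S` is a finite set of places containing every `u` with `φ_u ≠ 𝟙_{K_u}` and `g_u ∈ K_u` off `S`, then
`toAdelic φ g = φ_∞(g_∞) · ∏_{u ∈ S} φ_u(g_u)` (a FINITE product). [cite: BorelJacquet1979, §4.1] -/
theorem toAdelic_apply_eq_prod (φ : GlobalTestFunction L N H) (S : Finset (HeightOneSpectrum (𝓞 ↥(maximalRealSubfield L))))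
    (hS : ∀ u, u ∉ S → φ.fin u = (cmLocalIntegralLevel L N H u : Set ((UnitaryGroup.cmDatum L N H).Local u)).indicator 1)
    {g : (UnitaryGroup.cmDatum L N H).Adelic} (hg : ∀ u, u ∉ S → locComp L N H u g ∈ cmLocalIntegralLevel L N H u) :
    toAdelic φ g = φ.arch (archPart (↥(maximalRealSubfield L)) L (IsCMField.complexConj L) N H g) * ∏ u ∈ S, φ.fin u (locComp L N H u g) := by
  rw [toAdelic_apply, ← finFactor_eq_prod φ S hS hg]
  rfl

end Summit.HodgeConjecture.HodgeConjecture.Cruxes.H413.K2E1GlobalTestFunctions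

end
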